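import Summits.Ventures.PercRepro.Conjectures
import Summits.Ventures.PercRepro.ConditionalNeg
import Summits.Ventures.PercRepro.Decide

/-!
# PercRepro — the closed rows of `conjectures/CONJECTURES.md` (typer-2, gen 2)

One theorem per CONJECTURES.md row whose named Prop (`Conjectures.lean`) is discharged by a landed
proof, so that the ledger "row ↦ theorem" is a single import:

* **`C002_holds : C002`** — C-002 (KNOWN, van den Berg–Häggström–Kahn 2006 Thm 1.4): p1's
  `MultiGraph.conn_neg_corr_of_sep` (ConditionalNeg.lean, from Theorem W);
* **`C003_holds : C003`** — C-003 (KNOWN, van den Berg–Kahn 2001 Thm 1.1): p1's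
  `MultiGraph.conditional_fkg` (TheoremW.lean);
* C-004 — `C004_holds : C004` is p5's (SMC3Proof.lean, via `C004_of_SMC3Principle`);
* **`not_H4 : ¬ H4`** — the planted control is refuted against the typed Prop by typer-1's
  kernel computation on the 4-cycle at `p = 1/10` (`H4_false_on_cycle4`, Decide.lean: the exact
  law of `KILLED.md`, third implementation);
* C-001 (KILLED) is refuted by the explicit instance in `KILLED.md` (no Lean refutation yet);
  C-005, C-006, C-007 are open (C-006 KNOWN: p3's strong FKG corollary is pending).
The distinctness hypotheses of the rows are not needed by the proofs (`_`).
-/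

namespace PercRepro

/-- **C-002 holds** (p1's `conn_neg_corr_of_sep`). -/
theorem C002_holds : C002 := fun G _ hp a b c d _ => G.conn_neg_corr_of_sep a b c d hp

/-- **C-003 holds** (p1's `conditional_fkg`). -/
theorem C003_holds : C003 := fun G _ hp s a b t _ => G.conditional_fkg s a b t hp

/-- **The planted control `H4` is FALSE**: the 4-cycle with `a, b, c = 0, 1, 2` and all weights
`1/10` (typer-1's `H4_false_on_cycle4`, computed by `decide`). -/
theorem not_H4 : ¬ H4 := fun h =>
  Examples.H4_false_on_cycle4 (h Examples.cycle4 (fun _ => (1 / 10 : ℝ))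
    (isProb_const (by norm_num) (by norm_num)) 0 1 2 (by decide))

end PercRepro
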